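import Summits.AnomalousDissipation.AnomalousDissipation.Theorems.MomentParityResolvedDissipationLevelLedger
import Summits.AnomalousDissipation.AnomalousDissipation.Theorems.MomentParityResolvedDissipationReduction
import Mathlib.Analysis.SpecialFunctions.SmoothTransition

/-!
# `MomentParity.ResolvedDissipation` (stmt-AnomalousDissipation-14284), line `enstrophy-ui-transfer`:
# the hard stub ⟺ uniform decay of the ENERGY FLUX THROUGH ENSTROPHY LEVELS

Supports stmt-AnomalousDissipation-14284 (helper of the line lead; nothing here closes an item).

With the smooth step `h_M(z) = smoothTransition(z/M − 1)` (`0` below `M`, `1` above `2M`, `C^∞`, nondecreasing) the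
level ledger (`…LevelLedger.lean`) of an admissible law `μ` at `(ν, f, N, R)` reads
`ν ∫ Z h_M(Z) dμ = ∫ (u,f) h_M(Z) dμ + Flux_M(μ)`,  `Flux_M(μ) := ∫ ‖u‖² h_M'(Z_N u) ⟨F(u), A P_N u⟩ dμ`
(`levelLedger_flux_form`): the enstrophy held above the level `M` is paid by the injection above the level — which is
`≤ R²‖f‖₂²/(νM)` UNIFORMLY (Chebyshev against the energy-row budget) — plus the energy flux `Flux_M` carried upward
across the levels `[M, 2M]` by enstrophy-raising (vortex-stretching) events. Hence, at each `(f, ν, R)`: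

* `uniformIntegrability_of_fluxDecay` — uniform decay `sup_{N, μ admissible} Flux_M(μ) → 0` (`M → ∞`) implies the
  hard stub's conclusion (uniform integrability of `‖∇u‖²` over the admissible family);
* `fluxDecay_of_uniformIntegrability` — conversely the hard stub's conclusion forces `sup |Flux_M| → 0`.

So the open content of the crux is EXACTLY the uniform decay of the energy flux through enstrophy levels; the
disprover's burst family is the scenario `Flux_M ≍ const` (worst-case stretching allows `R² M E[Z; Z>M]/ν³`).
-/

noncomputable section

-- `Summit.<Summit>.<Problem>`: single-conjunct summit, the duplicate namespace segment is mandated.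
set_option linter.dupNamespace false

namespace Summit.AnomalousDissipation.AnomalousDissipation.Theorems.MomentParityResolvedDissipation

open MeasureTheory Filter Topology
open scoped ENNReal InnerProductSpace RealInnerProductSpace
open Literature.Analysis.FunctionSpaces Literature.Analysis.FluidPDE
open Summit.AnomalousDissipation.AnomalousDissipation.Theses.MomentParity
open Summit.AnomalousDissipation.AnomalousDissipation.Theorems.CubicParityLoud.Negative (T3 R3 H3 L2T3)
open Summit.AnomalousDissipation.AnomalousDissipation.Theorems.QuarticGate.Negative
  (IsLevel IsBandTest polyGrad IsPolyStationary)

/-! ## The smooth step -/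

/-- The smooth step `h_M(z) = smoothTransition(z/M − 1)` is `C¹`. [folklore] -/
theorem contDiff_smoothStep (M : ℝ) : ContDiff ℝ 1 (fun z : ℝ => Real.smoothTransition (z / M - 1)) :=
  Real.smoothTransition.contDiff.comp ((contDiff_id.div_const M).sub contDiff_const)

/-- `h_M` vanishes below `M` (`M > 0`). [folklore] -/
theorem smoothStep_eq_zero {M z : ℝ} (hM : 0 < M) (hz : z ≤ M) : Real.smoothTransition (z / M - 1) = 0 :=
  Real.smoothTransition.zero_of_nonpos (by rw [sub_nonpos, div_le_one hM]; exact hz)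

/-- `h_M = 1` above `2M` (`M > 0`). [folklore] -/
theorem smoothStep_eq_one {M z : ℝ} (hM : 0 < M) (hz : 2 * M ≤ z) : Real.smoothTransition (z / M - 1) = 1 :=
  Real.smoothTransition.one_of_one_le (by rw [le_sub_iff_add_le, le_div_iff₀ hM]; linarith)

/-- `h_M` is nondecreasing, so `h_M' ≥ 0` (`M > 0`). [folklore] -/
theorem deriv_smoothStep_nonneg {M : ℝ} (hM : 0 < M) (z : ℝ) :
    0 ≤ deriv (fun z : ℝ => Real.smoothTransition (z / M - 1)) z := by
  have hmono : Monotone fun z : ℝ => Real.smoothTransition (z / M - 1) := fun a b hab =>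
    Real.smoothTransition.monotone (by
      simp only [sub_le_sub_iff_right]
      exact div_le_div_of_nonneg_right hab hM.le)
  exact hmono.deriv_nonneg

/-- `0 ≤ h_M ≤ z/M` on `z ≥ 0` (`M > 0`). [folklore] -/
theorem smoothStep_le_div {M z : ℝ} (hM : 0 < M) (hz : 0 ≤ z) : Real.smoothTransition (z / M - 1) ≤ z / M := by
  by_cases h : z ≤ M
  · rw [smoothStep_eq_zero hM h]; positivity
  · exact (Real.smoothTransition.le_one _).trans ((one_le_div hM).2 (le_of_not_ge h))

/-! ## The level ledger in flux form -/

/-- **The level ledger in flux form.** For an admissible law `μ` at `(ν, f, N, R)` and a level scale `M`: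
`ν ∫ Z_N h_M(Z_N) dμ = ∫ (u,f) h_M(Z_N) dμ + ∫ ‖u‖² h_M'(Z_N) ⟨F(u), A P_N u⟩ dμ`, all three integrands integrable
(`levelLedger` with `h = h_M`, `⟨F(u), P_N u⟩ = (u,f) − ν‖∇u‖²` on level-`N` fields, continuity on the compact carrier).
[folklore] -/
theorem levelLedger_flux_form {ν : ℝ} {f : T3 → R3} (hf : Torus.IsSmooth f) {N : ℕ} {R : ℝ}
    {μ : Measure H3} (hP : IsProbabilityMeasure μ) (hL : ∀ᵐ u ∂μ, IsLevel N u) (hB : ∀ᵐ u ∂μ, ‖u‖ ≤ R)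
    (hS : ∀ d : ℕ, IsPolyStationary ν f N d μ) (M : ℝ) :
    Integrable (fun u : H3 => (4 * Real.pi ^ 2 * ∑ k ∈ Torus.freqBall N, Torus.freqNormSq k *
          ‖UnitAddTorus.mFourierCoeff (EuclideanSpace.complexify ∘ (u.1 : T3 → R3)) k‖ ^ 2) *
        Real.smoothTransition ((4 * Real.pi ^ 2 * ∑ k ∈ Torus.freqBall N, Torus.freqNormSq k *
          ‖UnitAddTorus.mFourierCoeff (EuclideanSpace.complexify ∘ (u.1 : T3 → R3)) k‖ ^ 2) / M - 1)) μ ∧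
    Integrable (fun u : H3 => Torus.pairing u.1 f *
        Real.smoothTransition ((4 * Real.pi ^ 2 * ∑ k ∈ Torus.freqBall N, Torus.freqNormSq k *
          ‖UnitAddTorus.mFourierCoeff (EuclideanSpace.complexify ∘ (u.1 : T3 → R3)) k‖ ^ 2) / M - 1)) μ ∧
    Integrable (fun u : H3 => ‖u‖ ^ 2 * deriv (fun z : ℝ => Real.smoothTransition (z / M - 1))
          (4 * Real.pi ^ 2 * ∑ k ∈ Torus.freqBall N, Torus.freqNormSq k *
            ‖UnitAddTorus.mFourierCoeff (EuclideanSpace.complexify ∘ (u.1 : T3 → R3)) k‖ ^ 2) *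
        Torus.nsGeneratorPairing ν f u (Torus.realTrigPoly (Torus.freqBall N) fun k =>
          (((4 * Real.pi ^ 2 * Torus.freqNormSq k : ℝ)) : ℂ) •
            UnitAddTorus.mFourierCoeff (EuclideanSpace.complexify ∘ (u.1 : T3 → R3)) k)) μ ∧
    ν * ∫ u, (4 * Real.pi ^ 2 * ∑ k ∈ Torus.freqBall N, Torus.freqNormSq k *
          ‖UnitAddTorus.mFourierCoeff (EuclideanSpace.complexify ∘ (u.1 : T3 → R3)) k‖ ^ 2) *
        Real.smoothTransition ((4 * Real.pi ^ 2 * ∑ k ∈ Torus.freqBall N, Torus.freqNormSq k *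
          ‖UnitAddTorus.mFourierCoeff (EuclideanSpace.complexify ∘ (u.1 : T3 → R3)) k‖ ^ 2) / M - 1) ∂μ =
      (∫ u, Torus.pairing u.1 f *
        Real.smoothTransition ((4 * Real.pi ^ 2 * ∑ k ∈ Torus.freqBall N, Torus.freqNormSq k *
          ‖UnitAddTorus.mFourierCoeff (EuclideanSpace.complexify ∘ (u.1 : T3 → R3)) k‖ ^ 2) / M - 1) ∂μ) +
      ∫ u, ‖u‖ ^ 2 * deriv (fun z : ℝ => Real.smoothTransition (z / M - 1))
          (4 * Real.pi ^ 2 * ∑ k ∈ Torus.freqBall N, Torus.freqNormSq k *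
            ‖UnitAddTorus.mFourierCoeff (EuclideanSpace.complexify ∘ (u.1 : T3 → R3)) k‖ ^ 2) *
        Torus.nsGeneratorPairing ν f u (Torus.realTrigPoly (Torus.freqBall N) fun k =>
          (((4 * Real.pi ^ 2 * Torus.freqNormSq k : ℝ)) : ℂ) •
            UnitAddTorus.mFourierCoeff (EuclideanSpace.complexify ∘ (u.1 : T3 → R3)) k) ∂μ := by
  haveI := hP
  -- abbreviations
  set Zr : H3 → ℝ := fun u => 4 * Real.pi ^ 2 * ∑ k ∈ Torus.freqBall N, Torus.freqNormSq k *
    ‖UnitAddTorus.mFourierCoeff (EuclideanSpace.complexify ∘ (u.1 : T3 → R3)) k‖ ^ 2 with hZr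
  set hMf : ℝ → ℝ := fun z => Real.smoothTransition (z / M - 1) with hhMf
  set Bf : H3 → ℝ := fun u => ‖u‖ ^ 2 * deriv hMf (Zr u) *
    Torus.nsGeneratorPairing ν f u (Torus.realTrigPoly (Torus.freqBall N) fun k =>
      (((4 * Real.pi ^ 2 * Torus.freqNormSq k : ℝ)) : ℂ) •
        UnitAddTorus.mFourierCoeff (EuclideanSpace.complexify ∘ (u.1 : T3 → R3)) k) with hBf
  -- the ledger with `h = h_M` on `U = univ`
  obtain ⟨hIrow, h0row⟩ := levelLedger ν f hf N R μ hP hL hB hS Set.univ hMf isOpen_univ (Set.subset_univ _)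
    (contDiff_smoothStep M).contDiffOn
  -- the compact carrier and continuity
  haveI : (ae μ).NeBot := ae_neBot.2 (IsProbabilityMeasure.ne_zero μ)
  obtain ⟨u₀, hu₀⟩ := hB.exists
  have hR : 0 ≤ R := (norm_nonneg _).trans hu₀
  have hμK : ∀ᵐ u ∂μ, u ∈ {u : H3 | CubicParityLoud.Negative.IsLevel N u ∧ ‖u‖ ≤ R} :=
    (hL.and hB).mono fun u hu => hu
  have hK := MomentParityMomentClosure.isCompact_levelBall N hR
  have hZc : Continuous Zr := MomentParityMomentClosure.continuous_bandEnstrophy (Torus.freqBall N)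
  have hhc : Continuous fun u : H3 => hMf (Zr u) := Real.smoothTransition.continuous.comp
    ((hZc.div_const M).sub continuous_const)
  have hpc : Continuous fun u : H3 => Torus.pairing u.1 f := Torus.continuous_pairing_coe (hf.memLp 2)
  have hI1 : Integrable (fun u : H3 => Zr u * hMf (Zr u)) μ :=
    MomentParityMomentClosure.integrable_of_continuous_of_ae_mem hK hμK (hZc.mul hhc)
  have hI2 : Integrable (fun u : H3 => Torus.pairing u.1 f * hMf (Zr u)) μ :=
    MomentParityMomentClosure.integrable_of_continuous_of_ae_mem hK hμK (hpc.mul hhc)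
  -- on level-`N` fields the energy-test row is `(u,f) − ν Z_N u`
  have hrowA : ∀ᵐ u ∂μ, hMf (Zr u) * Torus.nsGeneratorPairing ν f u (Torus.fourierTruncate N (u.1 : T3 → R3)) =
      Torus.pairing u.1 f * hMf (Zr u) - ν * (Zr u * hMf (Zr u)) := by
    filter_upwards [hL] with u hu
    rw [nsGeneratorPairing_fourierTruncate_of_isLevel ν f hu,
      MomentParityMomentClosure.eGradNormSq_coe_of_isLevel hu, ENNReal.toReal_ofReal
        (MomentParityMomentClosure.bandEnstrophy_nonneg _ _)]
    ring
  have hIA : Integrable (fun u : H3 => hMf (Zr u) *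
      Torus.nsGeneratorPairing ν f u (Torus.fourierTruncate N (u.1 : T3 → R3))) μ :=
    (hI2.sub (hI1.const_mul ν)).congr (hrowA.mono fun u hu => hu.symm)
  have hIB : Integrable Bf μ :=
    (hIrow.sub hIA).congr (ae_of_all _ fun u => by rw [Pi.sub_apply]; exact add_sub_cancel_left _ _)
  have hsum : ∫ u, (hMf (Zr u) * Torus.nsGeneratorPairing ν f u (Torus.fourierTruncate N (u.1 : T3 → R3)) +
      Bf u) ∂μ = 0 := h0row
  rw [integral_add hIA hIB, integral_congr_ae hrowA, integral_sub hI2 (hI1.const_mul ν), integral_const_mul] at hsum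
  refine ⟨hI1, hI2, hIB, ?_⟩
  linarith

/-! ## The budget and the injection above the level -/

/-- **Mean band enstrophy of an admissible law, real form**: `∫ Z_N dμ ≤ ‖f‖₂ R/ν` (energy-row budget
`ensembleEnstrophy_le_budget` made real on the compact carrier). [folklore] -/
theorem integral_bandEnstrophy_le_budget {ν : ℝ} (hν : 0 < ν) {f : T3 → R3} (hf : Torus.IsSmooth f) {N : ℕ} {R : ℝ}
    {μ : Measure H3} (hP : IsProbabilityMeasure μ) (hL : ∀ᵐ u ∂μ, IsLevel N u) (hB : ∀ᵐ u ∂μ, ‖u‖ ≤ R)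
    (hS : ∀ d : ℕ, IsPolyStationary ν f N d μ) :
    ∫ u, (4 * Real.pi ^ 2 * ∑ k ∈ Torus.freqBall N, Torus.freqNormSq k *
        ‖UnitAddTorus.mFourierCoeff (EuclideanSpace.complexify ∘ (u.1 : T3 → R3)) k‖ ^ 2) ∂μ ≤
      ‖(hf.memLp 2).toLp f‖ * R / ν := by
  haveI := hP
  haveI : (ae μ).NeBot := ae_neBot.2 (IsProbabilityMeasure.ne_zero μ)
  obtain ⟨u₀, hu₀⟩ := hB.exists
  have hR : 0 ≤ R := (norm_nonneg _).trans hu₀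
  have hμK : ∀ᵐ u ∂μ, u ∈ {u : H3 | CubicParityLoud.Negative.IsLevel N u ∧ ‖u‖ ≤ R} :=
    (hL.and hB).mono fun u hu => hu
  have hbud := ensembleEnstrophy_le_budget hν (hf.memLp 2) hP hL hB hS
  unfold Torus.ensembleEnstrophy at hbud
  rw [MomentParityMomentClosure.lintegral_eGradNormSq_eq hR hμK] at hbud
  have hnn : 0 ≤ ∫ u, (4 * Real.pi ^ 2 * ∑ k ∈ Torus.freqBall N, Torus.freqNormSq k *
      ‖UnitAddTorus.mFourierCoeff (EuclideanSpace.complexify ∘ (u.1 : T3 → R3)) k‖ ^ 2) ∂μ :=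
    integral_nonneg fun u => MomentParityMomentClosure.bandEnstrophy_nonneg _ _
  have hKR : 0 ≤ ‖(hf.memLp 2).toLp f‖ * R / ν := by positivity
  rw [CubicParityLoud.Negative.norm_toLp_eq_sqrt (hf.memLp 2)]
  rw [CubicParityLoud.Negative.norm_toLp_eq_sqrt (hf.memLp 2)] at hKR
  exact (ENNReal.ofReal_le_ofReal_iff hKR).1 hbud

/-- **The injection above the level is uniformly small**: for an admissible law `μ` at `(ν, f, N, R)` and `M > 0`,
`∫ (u,f) h_M(Z_N u) dμ ≤ R²‖f‖₂²/(νM)` (`|(u,f)| ≤ ‖f‖₂R`, `h_M(z) ≤ z/M`, budget). [folklore] -/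
theorem abs_integral_injection_le {ν : ℝ} (hν : 0 < ν) {f : T3 → R3} (hf : Torus.IsSmooth f) {N : ℕ} {R : ℝ}
    {μ : Measure H3} (hP : IsProbabilityMeasure μ) (hL : ∀ᵐ u ∂μ, IsLevel N u) (hB : ∀ᵐ u ∂μ, ‖u‖ ≤ R)
    (hS : ∀ d : ℕ, IsPolyStationary ν f N d μ) {M : ℝ} (hM : 0 < M) :
    |∫ u, Torus.pairing u.1 f *
        Real.smoothTransition ((4 * Real.pi ^ 2 * ∑ k ∈ Torus.freqBall N, Torus.freqNormSq k *
          ‖UnitAddTorus.mFourierCoeff (EuclideanSpace.complexify ∘ (u.1 : T3 → R3)) k‖ ^ 2) / M - 1) ∂μ| ≤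
      R ^ 2 * ‖(hf.memLp 2).toLp f‖ ^ 2 / (ν * M) := by
  haveI := hP
  set Zr : H3 → ℝ := fun u => 4 * Real.pi ^ 2 * ∑ k ∈ Torus.freqBall N, Torus.freqNormSq k *
    ‖UnitAddTorus.mFourierCoeff (EuclideanSpace.complexify ∘ (u.1 : T3 → R3)) k‖ ^ 2 with hZr
  set Kf : ℝ := ‖(hf.memLp 2).toLp f‖ with hKf
  have hKf0 : 0 ≤ Kf := norm_nonneg _
  haveI : (ae μ).NeBot := ae_neBot.2 (IsProbabilityMeasure.ne_zero μ)
  obtain ⟨u₀, hu₀⟩ := hB.exists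
  have hR : 0 ≤ R := (norm_nonneg _).trans hu₀
  have hμK : ∀ᵐ u ∂μ, u ∈ {u : H3 | CubicParityLoud.Negative.IsLevel N u ∧ ‖u‖ ≤ R} :=
    (hL.and hB).mono fun u hu => hu
  have hK := MomentParityMomentClosure.isCompact_levelBall N hR
  have hZc : Continuous Zr := MomentParityMomentClosure.continuous_bandEnstrophy (Torus.freqBall N)
  have hIZ : Integrable Zr μ := MomentParityMomentClosure.integrable_of_continuous_of_ae_mem hK hμK hZc
  -- pointwise: `|(u,f) h_M(Z)| ≤ (R Kf / M) Z` a.e.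
  have hpt : ∀ᵐ u ∂μ, ‖Torus.pairing u.1 f * Real.smoothTransition (Zr u / M - 1)‖ ≤ R * Kf / M * Zr u := by
    filter_upwards [hB] with u hu
    have hZ0 : 0 ≤ Zr u := MomentParityMomentClosure.bandEnstrophy_nonneg _ _
    have h1 : |Torus.pairing u.1 f| ≤ R * Kf :=
      (Torus.abs_pairing_coe_le (hf.memLp 2) u).trans (by rw [hKf]; gcongr)
    have h2 : 0 ≤ Real.smoothTransition (Zr u / M - 1) := Real.smoothTransition.nonneg _
    have h3 : Real.smoothTransition (Zr u / M - 1) ≤ Zr u / M := smoothStep_le_div hM hZ0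
    rw [Real.norm_eq_abs, abs_mul, abs_of_nonneg h2]
    calc |Torus.pairing u.1 f| * Real.smoothTransition (Zr u / M - 1) ≤ (R * Kf) * (Zr u / M) :=
          mul_le_mul h1 h3 h2 (by positivity)
      _ = R * Kf / M * Zr u := by ring
  have hint := norm_integral_le_of_norm_le (hIZ.const_mul (R * Kf / M)) hpt
  rw [Real.norm_eq_abs, integral_const_mul] at hint
  have hbud := integral_bandEnstrophy_le_budget hν hf hP hL hB hS
  rw [← hKf] at hbud
  calc |∫ u, Torus.pairing u.1 f * Real.smoothTransition (Zr u / M - 1) ∂μ| ≤ R * Kf / M * ∫ u, Zr u ∂μ := hint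
    _ ≤ R * Kf / M * (Kf * R / ν) := mul_le_mul_of_nonneg_left hbud (by positivity)
    _ = R ^ 2 * Kf ^ 2 / (ν * M) := by field_simp


/-! ## The hard stub ⟺ uniform flux decay -/

/-- **Uniform decay of the energy flux through enstrophy levels implies the hard stub** (at each `(f, ν, R)`).
If `sup {Flux_M(μ) : N, μ admissible at (ν, f, N, R)} → 0` as `M → ∞`, where
`Flux_M(μ) = ∫ ‖u‖² h_M'(Z_N u) ⟨F(u), A P_N u⟩ dμ` and `h_M(z) = smoothTransition(z/M − 1)`, then the enstrophy is
uniformly integrable over the admissible family, uniformly in `N`: by the flux form of the level ledger,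
`ν ∫_{Z>2M} Z ≤ ν ∫ Z h_M(Z) = ∫ (u,f) h_M(Z) + Flux_M ≤ R²‖f‖₂²/(νM) + Flux_M`. [folklore] -/
theorem uniformIntegrability_of_fluxDecay :
    ∀ (f : T3 → R3), Torus.IsSmooth f → ∀ (ν : ℝ), 0 < ν → ∀ (R : ℝ),
    (∀ ε : ℝ, 0 < ε → ∃ M₀ : ℝ, 0 < M₀ ∧ ∀ M : ℝ, M₀ ≤ M →
      ∀ (N : ℕ) (μ : Measure (Torus.energySpace (Fin 3))), IsProbabilityMeasure μ →
        (∀ᵐ u ∂μ, IsLevel N u) → (∀ᵐ u ∂μ, ‖u‖ ≤ R) → (∀ d : ℕ, IsPolyStationary ν f N d μ) →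
        ∫ u, ‖u‖ ^ 2 * deriv (fun z : ℝ => Real.smoothTransition (z / M - 1))
            (4 * Real.pi ^ 2 * ∑ k ∈ Torus.freqBall N, Torus.freqNormSq k *
            ‖UnitAddTorus.mFourierCoeff (EuclideanSpace.complexify ∘ (u.1 : T3 → R3)) k‖ ^ 2) *
          Torus.nsGeneratorPairing ν f u (Torus.realTrigPoly (Torus.freqBall N) fun k =>
            (((4 * Real.pi ^ 2 * Torus.freqNormSq k : ℝ)) : ℂ) •
              UnitAddTorus.mFourierCoeff (EuclideanSpace.complexify ∘ (u.1 : T3 → R3)) k) ∂μ ≤ ε) →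
    ∀ ε : ℝ≥0∞, 0 < ε → ∃ M : ℝ≥0∞, M ≠ ⊤ ∧
      ∀ (N : ℕ) (μ : Measure (Torus.energySpace (Fin 3))), IsProbabilityMeasure μ →
        (∀ᵐ u ∂μ, IsLevel N u) → (∀ᵐ u ∂μ, ‖u‖ ≤ R) → (∀ d : ℕ, IsPolyStationary ν f N d μ) →
        ∫⁻ u in {u : Torus.energySpace (Fin 3) |
            M < Torus.eGradNormSq (u.1 : UnitAddTorus (Fin 3) → EuclideanSpace ℝ (Fin 3))},
          Torus.eGradNormSq (u.1 : UnitAddTorus (Fin 3) → EuclideanSpace ℝ (Fin 3)) ∂μ ≤ ε := by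
  intro f hf ν hν R hflux ε hε
  by_cases hεtop : ε = ⊤
  · exact ⟨0, ENNReal.zero_ne_top, fun N μ _ _ _ _ => by rw [hεtop]; exact le_top⟩
  set e : ℝ := ε.toReal with he_def
  have he : 0 < e := ENNReal.toReal_pos hε.ne' hεtop
  set Kf : ℝ := ‖(hf.memLp 2).toLp f‖ with hKf
  obtain ⟨M₀, hM₀, hFl⟩ := hflux (ν * e / 2) (by positivity)
  set M : ℝ := max M₀ (2 * R ^ 2 * Kf ^ 2 / (ν ^ 2 * e) + 1) with hM_def
  have hM₀M : M₀ ≤ M := le_max_left _ _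
  have hMpos : 0 < M := hM₀.trans_le hM₀M
  have hMbig : 2 * R ^ 2 * Kf ^ 2 ≤ M * (ν ^ 2 * e) := by
    have h1 : 2 * R ^ 2 * Kf ^ 2 / (ν ^ 2 * e) ≤ M := by
      have := le_max_right M₀ (2 * R ^ 2 * Kf ^ 2 / (ν ^ 2 * e) + 1); linarith
    exact (div_le_iff₀ (by positivity)).1 h1
  refine ⟨ENNReal.ofReal (2 * M), ENNReal.ofReal_ne_top, fun N μ hP hL hB hS => ?_⟩
  haveI := hP
  set Zr : H3 → ℝ := fun u => 4 * Real.pi ^ 2 * ∑ k ∈ Torus.freqBall N, Torus.freqNormSq k *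
    ‖UnitAddTorus.mFourierCoeff (EuclideanSpace.complexify ∘ (u.1 : T3 → R3)) k‖ ^ 2 with hZr
  set hMf : ℝ → ℝ := fun z => Real.smoothTransition (z / M - 1) with hhMf
  obtain ⟨hI1, -, -, hled⟩ := levelLedger_flux_form hf hP hL hB hS M
  have hinj := abs_integral_injection_le hν hf hP hL hB hS hMpos
  have hfl := hFl M hM₀M N μ hP hL hB hS
  -- the real estimate `∫ Z h_M(Z) ≤ e`
  have hinj' : R ^ 2 * Kf ^ 2 / (ν * M) ≤ ν * e / 2 := by
    rw [div_le_iff₀ (by positivity)]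
    nlinarith [hMbig]
  have hX : ∫ u, Zr u * hMf (Zr u) ∂μ ≤ e := by
    have h1 : ν * ∫ u, Zr u * hMf (Zr u) ∂μ ≤ ν * e := by
      rw [hled]
      have := (abs_le.1 hinj).2
      linarith
    exact le_of_mul_le_mul_left h1 hν
  -- transfer to `ℝ≥0∞`
  have hSm : MeasurableSet {u : H3 | ENNReal.ofReal (2 * M) < Torus.eGradNormSq (u.1 : T3 → R3)} :=
    measurableSet_lt measurable_const Torus.measurable_eGradNormSq_coe
  have hpt : ∀ᵐ u ∂μ, {u : H3 | ENNReal.ofReal (2 * M) < Torus.eGradNormSq (u.1 : T3 → R3)}.indicator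
      (fun u : H3 => Torus.eGradNormSq (u.1 : T3 → R3)) u ≤ ENNReal.ofReal (Zr u * hMf (Zr u)) := by
    filter_upwards [hL] with u hu
    have hZ0 : 0 ≤ Zr u := MomentParityMomentClosure.bandEnstrophy_nonneg _ _
    have hEq : Torus.eGradNormSq (u.1 : T3 → R3) = ENNReal.ofReal (Zr u) :=
      MomentParityMomentClosure.eGradNormSq_coe_of_isLevel hu
    by_cases hmem : u ∈ {u : H3 | ENNReal.ofReal (2 * M) < Torus.eGradNormSq (u.1 : T3 → R3)}
    · rw [Set.indicator_of_mem hmem, hEq]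
      have h2M : 2 * M < Zr u := by
        have := hmem
        rw [Set.mem_setOf_eq, hEq, ENNReal.ofReal_lt_ofReal_iff_of_nonneg (by positivity)] at this
        exact this
      rw [show hMf (Zr u) = 1 from smoothStep_eq_one hMpos h2M.le, mul_one]
    · rw [Set.indicator_of_notMem hmem]
      exact bot_le
  calc ∫⁻ u in {u : H3 | ENNReal.ofReal (2 * M) < Torus.eGradNormSq (u.1 : T3 → R3)},
        Torus.eGradNormSq (u.1 : T3 → R3) ∂μ
      = ∫⁻ u, {u : H3 | ENNReal.ofReal (2 * M) < Torus.eGradNormSq (u.1 : T3 → R3)}.indicator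
          (fun u : H3 => Torus.eGradNormSq (u.1 : T3 → R3)) u ∂μ := (lintegral_indicator hSm _).symm
    _ ≤ ∫⁻ u, ENNReal.ofReal (Zr u * hMf (Zr u)) ∂μ := lintegral_mono_ae hpt
    _ = ENNReal.ofReal (∫ u, Zr u * hMf (Zr u) ∂μ) :=
        (ofReal_integral_eq_lintegral_ofReal hI1 (ae_of_all _ fun u => mul_nonneg
          (MomentParityMomentClosure.bandEnstrophy_nonneg _ _) (Real.smoothTransition.nonneg _))).symm
    _ ≤ ENNReal.ofReal e := ENNReal.ofReal_le_ofReal hX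
    _ = ε := ENNReal.ofReal_toReal hεtop

/-- **The hard stub implies uniform decay of the energy flux through enstrophy levels** (at each `(f, ν, R)`):
if the enstrophy is uniformly integrable over the admissible family, uniformly in `N`, then
`sup {|Flux_M(μ)| : N, μ admissible} → 0` as `M → ∞` — by the flux form of the level ledger,
`Flux_M = ν ∫ Z h_M(Z) − ∫ (u,f) h_M(Z)` with `0 ≤ ν∫ Z h_M(Z) ≤ ν ∫_{Z>M} Z` and `|∫ (u,f) h_M(Z)| ≤ R²‖f‖₂²/(νM)`.
Together with `uniformIntegrability_of_fluxDecay`: the open content of the crux `ResolvedDissipation` at `(f, ν, R)`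
is exactly the uniform decay of the energy flux through enstrophy levels. [folklore] -/
theorem fluxDecay_of_uniformIntegrability :
    ∀ (f : T3 → R3), Torus.IsSmooth f → ∀ (ν : ℝ), 0 < ν → ∀ (R : ℝ),
    (∀ ε : ℝ≥0∞, 0 < ε → ∃ M : ℝ≥0∞, M ≠ ⊤ ∧
      ∀ (N : ℕ) (μ : Measure (Torus.energySpace (Fin 3))), IsProbabilityMeasure μ →
        (∀ᵐ u ∂μ, IsLevel N u) → (∀ᵐ u ∂μ, ‖u‖ ≤ R) → (∀ d : ℕ, IsPolyStationary ν f N d μ) →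
        ∫⁻ u in {u : Torus.energySpace (Fin 3) |
            M < Torus.eGradNormSq (u.1 : UnitAddTorus (Fin 3) → EuclideanSpace ℝ (Fin 3))},
          Torus.eGradNormSq (u.1 : UnitAddTorus (Fin 3) → EuclideanSpace ℝ (Fin 3)) ∂μ ≤ ε) →
    ∀ ε : ℝ, 0 < ε → ∃ M₀ : ℝ, 0 < M₀ ∧ ∀ M : ℝ, M₀ ≤ M →
      ∀ (N : ℕ) (μ : Measure (Torus.energySpace (Fin 3))), IsProbabilityMeasure μ →
        (∀ᵐ u ∂μ, IsLevel N u) → (∀ᵐ u ∂μ, ‖u‖ ≤ R) → (∀ d : ℕ, IsPolyStationary ν f N d μ) →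
        |∫ u, ‖u‖ ^ 2 * deriv (fun z : ℝ => Real.smoothTransition (z / M - 1))
            (4 * Real.pi ^ 2 * ∑ k ∈ Torus.freqBall N, Torus.freqNormSq k *
            ‖UnitAddTorus.mFourierCoeff (EuclideanSpace.complexify ∘ (u.1 : T3 → R3)) k‖ ^ 2) *
          Torus.nsGeneratorPairing ν f u (Torus.realTrigPoly (Torus.freqBall N) fun k =>
            (((4 * Real.pi ^ 2 * Torus.freqNormSq k : ℝ)) : ℂ) •
              UnitAddTorus.mFourierCoeff (EuclideanSpace.complexify ∘ (u.1 : T3 → R3)) k) ∂μ| ≤ ε := by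
  intro f hf ν hν R hUI e he
  set Kf : ℝ := ‖(hf.memLp 2).toLp f‖ with hKf
  obtain ⟨Mx, hMx, hU⟩ := hUI (ENNReal.ofReal (e / (2 * ν))) (ENNReal.ofReal_pos.2 (by positivity))
  refine ⟨max Mx.toReal (2 * R ^ 2 * Kf ^ 2 / (ν * e)) + 1,
    lt_of_lt_of_le zero_lt_one (le_add_of_nonneg_left (le_max_of_le_left ENNReal.toReal_nonneg)),
    fun M hM N μ hP hL hB hS => ?_⟩
  haveI := hP
  have hMx' : Mx.toReal < M := by
    have := le_max_left Mx.toReal (2 * R ^ 2 * Kf ^ 2 / (ν * e)); linarith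
  have hMpos : 0 < M := lt_of_le_of_lt ENNReal.toReal_nonneg hMx'
  have hMbig : 2 * R ^ 2 * Kf ^ 2 ≤ M * (ν * e) := by
    have h1 : 2 * R ^ 2 * Kf ^ 2 / (ν * e) ≤ M := by
      have := le_max_right Mx.toReal (2 * R ^ 2 * Kf ^ 2 / (ν * e)); linarith
    exact (div_le_iff₀ (by positivity)).1 h1
  set Zr : H3 → ℝ := fun u => 4 * Real.pi ^ 2 * ∑ k ∈ Torus.freqBall N, Torus.freqNormSq k *
    ‖UnitAddTorus.mFourierCoeff (EuclideanSpace.complexify ∘ (u.1 : T3 → R3)) k‖ ^ 2 with hZr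
  set hMf : ℝ → ℝ := fun z => Real.smoothTransition (z / M - 1) with hhMf
  obtain ⟨hI1, -, -, hled⟩ := levelLedger_flux_form hf hP hL hB hS M
  have hinj := abs_integral_injection_le hν hf hP hL hB hS hMpos
  have hinj' : R ^ 2 * Kf ^ 2 / (ν * M) ≤ e / 2 := by
    rw [div_le_iff₀ (by positivity)]
    nlinarith [hMbig]
  -- `0 ≤ ∫ Z h_M(Z) ≤ e/(2ν)` from uniform integrability at the level `Mx < ofReal M`
  have hX0 : 0 ≤ ∫ u, Zr u * hMf (Zr u) ∂μ := integral_nonneg fun u =>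
    mul_nonneg (MomentParityMomentClosure.bandEnstrophy_nonneg _ _) (Real.smoothTransition.nonneg _)
  have hSm : MeasurableSet {u : H3 | Mx < Torus.eGradNormSq (u.1 : T3 → R3)} :=
    measurableSet_lt measurable_const Torus.measurable_eGradNormSq_coe
  have hpt : ∀ᵐ u ∂μ, ENNReal.ofReal (Zr u * hMf (Zr u)) ≤
      {u : H3 | Mx < Torus.eGradNormSq (u.1 : T3 → R3)}.indicator
        (fun u : H3 => Torus.eGradNormSq (u.1 : T3 → R3)) u := by
    filter_upwards [hL] with u hu
    have hZ0 : 0 ≤ Zr u := MomentParityMomentClosure.bandEnstrophy_nonneg _ _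
    have hEq : Torus.eGradNormSq (u.1 : T3 → R3) = ENNReal.ofReal (Zr u) :=
      MomentParityMomentClosure.eGradNormSq_coe_of_isLevel hu
    by_cases hzM : Zr u ≤ M
    · rw [show hMf (Zr u) = 0 from smoothStep_eq_zero hMpos hzM, mul_zero, ENNReal.ofReal_zero]
      exact bot_le
    · have hmem : u ∈ {u : H3 | Mx < Torus.eGradNormSq (u.1 : T3 → R3)} := by
        rw [Set.mem_setOf_eq, hEq, ← ENNReal.ofReal_toReal hMx]
        exact (ENNReal.ofReal_lt_ofReal_iff_of_nonneg ENNReal.toReal_nonneg).2 (by linarith [le_of_not_ge hzM])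
      rw [Set.indicator_of_mem hmem, hEq]
      exact ENNReal.ofReal_le_ofReal (mul_le_of_le_one_right hZ0 (Real.smoothTransition.le_one _))
  have hX : ∫ u, Zr u * hMf (Zr u) ∂μ ≤ e / (2 * ν) := by
    have h1 : ENNReal.ofReal (∫ u, Zr u * hMf (Zr u) ∂μ) ≤ ENNReal.ofReal (e / (2 * ν)) :=
      calc ENNReal.ofReal (∫ u, Zr u * hMf (Zr u) ∂μ)
          = ∫⁻ u, ENNReal.ofReal (Zr u * hMf (Zr u)) ∂μ :=
            ofReal_integral_eq_lintegral_ofReal hI1 (ae_of_all _ fun u => mul_nonneg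
              (MomentParityMomentClosure.bandEnstrophy_nonneg _ _) (Real.smoothTransition.nonneg _))
        _ ≤ ∫⁻ u, {u : H3 | Mx < Torus.eGradNormSq (u.1 : T3 → R3)}.indicator
              (fun u : H3 => Torus.eGradNormSq (u.1 : T3 → R3)) u ∂μ := lintegral_mono_ae hpt
        _ = ∫⁻ u in {u : H3 | Mx < Torus.eGradNormSq (u.1 : T3 → R3)}, Torus.eGradNormSq (u.1 : T3 → R3) ∂μ :=
            lintegral_indicator hSm _
        _ ≤ ENNReal.ofReal (e / (2 * ν)) := hU N μ hP hL hB hS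
    exact (ENNReal.ofReal_le_ofReal_iff (by positivity)).1 h1
  have hνX : ν * ∫ u, Zr u * hMf (Zr u) ∂μ ≤ e / 2 := by
    calc ν * ∫ u, Zr u * hMf (Zr u) ∂μ ≤ ν * (e / (2 * ν)) := mul_le_mul_of_nonneg_left hX hν.le
      _ = e / 2 := by field_simp
  have hνX0 : 0 ≤ ν * ∫ u, Zr u * hMf (Zr u) ∂μ := mul_nonneg hν.le hX0
  obtain ⟨hP1, hP2⟩ := abs_le.1 (hinj.trans hinj')
  rw [abs_le]
  constructor <;> linarith

end Summit.AnomalousDissipation.AnomalousDissipation.Theorems.MomentParityResolvedDissipation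

end
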